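import Mathlib
import HarnessLib

/-!
# The regularised maximum of two real numbers (and of two `C²` functions)

Topic `Literature/Analysis/Pluripotential`. The standard smooth convex replacement of `max(x, y)`
used to glue plurisubharmonic functions (the "regularised max" of pluripotential theory, here in the
elementary two-variable form `m_η(x, y) = ½ (x + y + η S((x - y)/η))` with `S` a smooth even convex
function equal to `|t|` for `|t| ≥ 1`), together with the calculus facts needed by the comparison
arguments for Monge–Ampère masses (`NonPluripolarMongeAmpereMass.lean`): `m_η` is `C^∞`, lies between
`max` and `max + η`, equals `x` where `x ≥ y + η` and `y` where `y ≥ x + η`, commutes with adding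
constants, is non-decreasing in each variable with partial derivatives `½(1 ± S') ∈ [0, 1]`, and has
non-negative second derivative `S''((x-y)/η) (ξ - ζ)² / (2η)`. Everything is a definition with a body
or a proved theorem.

## Main definitions and results

* `smoothSign` — `σ(s) = 2·smoothTransition((s+1)/2) − 1`: smooth, odd, non-decreasing, `= ±1` for
  `±s ≥ 1`, `|σ| ≤ 1`.
* `smoothAbs` — `S(t) = 1 + ∫_{-1}^t σ`: smooth, convex, `S' = σ`, `S(t) = |t|` for `|t| ≥ 1`,
  `|t| ≤ S(t) ≤ |t| + 1`.
* `smoothMax η x y = (x + y + η S((x - y)/η)) / 2` (`η > 0`) and its properties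
  `max_le_smoothMax`, `smoothMax_le_max_add`, `smoothMax_eq_left/right`, `smoothMax_add_const`,
  `contDiff_smoothMax`.

## References

* J.-P. Demailly, Complex analytic and differential geometry, Ch. I, Lemma 5.18 (regularised
  maximum); here only the two-variable elementary version is needed. Tagged folklore.
-/

noncomputable section

open Set Filter MeasureTheory
open scoped Topology ContDiff

namespace Literature.Analysis.Pluripotential

/-! ### A smooth odd sign function -/

/-- Symmetry of Mathlib's smooth transition: `smoothTransition (1 - x) = 1 - smoothTransition x`
(private copy of `Literature.NumberTheory.LFunctions.SelfDualAFE.smoothTransition_one_sub`, which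
lives in an unrelated part of the library). [folklore] -/
private theorem smoothTransition_one_sub (x : ℝ) :
    Real.smoothTransition (1 - x) = 1 - Real.smoothTransition x := by
  have h := Real.smoothTransition.pos_denom x
  unfold Real.smoothTransition
  rw [sub_sub_cancel, add_comm (expNegInvGlue (1 - x)) (expNegInvGlue x)]
  field_simp
  ring

/-- The **smooth sign** `σ(s) = 2·smoothTransition((s + 1)/2) − 1`: a `C^∞`, odd, non-decreasing
function with `σ = -1` on `(-∞, -1]`, `σ = 1` on `[1, ∞)`. [folklore] -/
def smoothSign (s : ℝ) : ℝ := 2 * Real.smoothTransition ((s + 1) / 2) - 1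

/-- `σ = 1` on `[1, ∞)`. [folklore] -/
theorem smoothSign_of_one_le {s : ℝ} (h : 1 ≤ s) : smoothSign s = 1 := by
  unfold smoothSign
  rw [Real.smoothTransition.one_of_one_le (by linarith)]
  norm_num

/-- `σ = -1` on `(-∞, -1]`. [folklore] -/
theorem smoothSign_of_le_neg_one {s : ℝ} (h : s ≤ -1) : smoothSign s = -1 := by
  unfold smoothSign
  rw [Real.smoothTransition.zero_of_nonpos (by linarith)]
  norm_num

/-- `σ` is odd. [folklore] -/
theorem smoothSign_neg (s : ℝ) : smoothSign (-s) = -smoothSign s := by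
  unfold smoothSign
  rw [show (-s + 1) / 2 = 1 - (s + 1) / 2 by ring, smoothTransition_one_sub]
  ring

/-- `-1 ≤ σ`. [folklore] -/
theorem neg_one_le_smoothSign (s : ℝ) : -1 ≤ smoothSign s := by
  unfold smoothSign
  linarith [Real.smoothTransition.nonneg ((s + 1) / 2)]

/-- `σ ≤ 1`. [folklore] -/
theorem smoothSign_le_one (s : ℝ) : smoothSign s ≤ 1 := by
  unfold smoothSign
  linarith [Real.smoothTransition.le_one ((s + 1) / 2)]

/-- `|σ| ≤ 1`. [folklore] -/
theorem abs_smoothSign_le_one (s : ℝ) : |smoothSign s| ≤ 1 :=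
  abs_le.2 ⟨neg_one_le_smoothSign s, smoothSign_le_one s⟩

/-- `σ` is non-decreasing. [folklore] -/
theorem monotone_smoothSign : Monotone smoothSign := fun a b hab ↦ by
  unfold smoothSign
  have := Real.smoothTransition.monotone (show (a + 1) / 2 ≤ (b + 1) / 2 by linarith)
  linarith

/-- `σ` is `C^∞`. [folklore] -/
theorem contDiff_smoothSign {n : ℕ∞} : ContDiff ℝ n smoothSign := by
  unfold smoothSign
  exact (contDiff_const.mul (Real.smoothTransition.contDiff.comp
    ((contDiff_id.add contDiff_const).div_const 2))).sub contDiff_const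

/-- `σ` is continuous. [folklore] -/
theorem continuous_smoothSign : Continuous smoothSign :=
  (contDiff_smoothSign (n := 0)).continuous

/-- `σ' ≥ 0`. [folklore] -/
theorem deriv_smoothSign_nonneg (s : ℝ) : 0 ≤ deriv smoothSign s :=
  monotone_smoothSign.deriv_nonneg

/-! ### A smooth convex absolute value -/

/-- The **smooth absolute value** `S(t) = 1 + ∫_{-1}^t σ(s) ds`: `C^∞`, convex, even, with
`S' = σ`, `S(t) = |t|` for `|t| ≥ 1` and `|t| ≤ S(t) ≤ |t| + 1`. [folklore] -/
def smoothAbs (t : ℝ) : ℝ := 1 + ∫ s in (-1 : ℝ)..t, smoothSign s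

/-- `S' = σ`. [folklore] -/
theorem hasDerivAt_smoothAbs (t : ℝ) : HasDerivAt smoothAbs (smoothSign t) t := by
  have h := intervalIntegral.integral_hasDerivAt_right
    (continuous_smoothSign.intervalIntegrable (-1) t)
    (continuous_smoothSign.stronglyMeasurableAtFilter volume (𝓝 t))
    continuous_smoothSign.continuousAt
  exact h.const_add 1

/-- `S' = σ` (as functions). [folklore] -/
theorem deriv_smoothAbs : deriv smoothAbs = smoothSign :=
  funext fun t ↦ (hasDerivAt_smoothAbs t).deriv

/-- `S` is differentiable. [folklore] -/
theorem differentiable_smoothAbs : Differentiable ℝ smoothAbs :=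
  fun t ↦ (hasDerivAt_smoothAbs t).differentiableAt

/-- `S` is `C^∞`. [folklore] -/
theorem contDiff_smoothAbs {n : ℕ∞} : ContDiff ℝ n smoothAbs := by
  have h : ContDiff ℝ ∞ smoothAbs :=
    contDiff_infty_iff_deriv.2 ⟨differentiable_smoothAbs, by
      rw [deriv_smoothAbs]; exact contDiff_smoothSign⟩
  exact h.of_le (by exact_mod_cast le_top)

/-- `S` is continuous. [folklore] -/
theorem continuous_smoothAbs : Continuous smoothAbs := differentiable_smoothAbs.continuous

/-- `∫_{-1}^{1} σ = 0` (`σ` is odd). [folklore] -/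
theorem integral_smoothSign_neg_one_one : ∫ s in (-1 : ℝ)..1, smoothSign s = 0 := by
  have h1 : ∫ s in (-1 : ℝ)..1, smoothSign (-s) = ∫ s in (-1 : ℝ)..1, smoothSign s := by
    rw [intervalIntegral.integral_comp_neg (fun s ↦ smoothSign s)]
    norm_num
  have h2 : ∫ s in (-1 : ℝ)..1, smoothSign (-s) = -∫ s in (-1 : ℝ)..1, smoothSign s := by
    simp only [smoothSign_neg, intervalIntegral.integral_neg]
  linarith

/-- `S(t) = t` for `t ≥ 1`. [folklore] -/
theorem smoothAbs_of_one_le {t : ℝ} (h : 1 ≤ t) : smoothAbs t = t := by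
  unfold smoothAbs
  rw [← intervalIntegral.integral_add_adjacent_intervals (b := 1)
    (continuous_smoothSign.intervalIntegrable _ _) (continuous_smoothSign.intervalIntegrable _ _),
    integral_smoothSign_neg_one_one, zero_add]
  have : ∫ s in (1 : ℝ)..t, smoothSign s = ∫ _ in (1 : ℝ)..t, (1 : ℝ) := by
    refine intervalIntegral.integral_congr fun s hs ↦ ?_
    rw [uIcc_of_le h] at hs
    exact smoothSign_of_one_le hs.1
  rw [this, intervalIntegral.integral_const, smul_eq_mul, mul_one]
  ring

/-- `S(t) = -t` for `t ≤ -1`. [folklore] -/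
theorem smoothAbs_of_le_neg_one {t : ℝ} (h : t ≤ -1) : smoothAbs t = -t := by
  unfold smoothAbs
  rw [intervalIntegral.integral_symm]
  have : ∫ s in t..(-1 : ℝ), smoothSign s = ∫ _ in t..(-1 : ℝ), (-1 : ℝ) := by
    refine intervalIntegral.integral_congr fun s hs ↦ ?_
    rw [uIcc_of_le h] at hs
    exact smoothSign_of_le_neg_one hs.2
  rw [this, intervalIntegral.integral_const, smul_eq_mul]
  ring

/-- `S(1) = 1`. [folklore] -/
theorem smoothAbs_one : smoothAbs 1 = 1 := smoothAbs_of_one_le le_rfl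

/-- `S(-1) = 1`. [folklore] -/
theorem smoothAbs_neg_one : smoothAbs (-1) = 1 := by
  rw [smoothAbs_of_le_neg_one le_rfl]; norm_num

/-- `t ↦ S(t) - t` is non-increasing (`S' ≤ 1`). [folklore] -/
theorem antitone_smoothAbs_sub_id : Antitone fun t ↦ smoothAbs t - t := by
  refine antitone_of_deriv_nonpos (differentiable_smoothAbs.sub differentiable_id) fun t ↦ ?_
  have h : HasDerivAt (fun t ↦ smoothAbs t - t) (smoothSign t - 1) t :=
    (hasDerivAt_smoothAbs t).sub (hasDerivAt_id t)
  rw [h.deriv]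
  linarith [smoothSign_le_one t]

/-- `t ↦ S(t) + t` is non-decreasing (`S' ≥ -1`). [folklore] -/
theorem monotone_smoothAbs_add_id : Monotone fun t ↦ smoothAbs t + t := by
  refine monotone_of_deriv_nonneg (differentiable_smoothAbs.add differentiable_id) fun t ↦ ?_
  have h : HasDerivAt (fun t ↦ smoothAbs t + t) (smoothSign t + 1) t :=
    (hasDerivAt_smoothAbs t).add (hasDerivAt_id t)
  rw [h.deriv]
  linarith [neg_one_le_smoothSign t]

/-- `t ≤ S(t)`. [folklore] -/
theorem le_smoothAbs (t : ℝ) : t ≤ smoothAbs t := by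
  rcases le_total t 1 with h | h
  · have := antitone_smoothAbs_sub_id h
    simp only [smoothAbs_one, sub_self] at this
    linarith
  · rw [smoothAbs_of_one_le h]

/-- `-t ≤ S(t)`. [folklore] -/
theorem neg_le_smoothAbs (t : ℝ) : -t ≤ smoothAbs t := by
  rcases le_total (-1) t with h | h
  · have := monotone_smoothAbs_add_id h
    simp only [smoothAbs_neg_one] at this
    linarith
  · rw [smoothAbs_of_le_neg_one h]

/-- `|t| ≤ S(t)`. [folklore] -/
theorem abs_le_smoothAbs (t : ℝ) : |t| ≤ smoothAbs t :=
  abs_le.2 ⟨by linarith [neg_le_smoothAbs t], le_smoothAbs t⟩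

/-- `S` is convex (`S' = σ` is non-decreasing). [folklore] -/
theorem convexOn_smoothAbs : ConvexOn ℝ univ smoothAbs :=
  Monotone.convexOn_univ_of_deriv differentiable_smoothAbs
    (by rw [deriv_smoothAbs]; exact monotone_smoothSign)

/-- `S(t) ≤ |t| + 1`. [folklore] -/
theorem smoothAbs_le_abs_add_one (t : ℝ) : smoothAbs t ≤ |t| + 1 := by
  rcases le_or_gt 1 t with h | h
  · rw [smoothAbs_of_one_le h]
    linarith [le_abs_self t]
  rcases le_or_gt t (-1) with h' | h'
  · rw [smoothAbs_of_le_neg_one h']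
    linarith [neg_le_abs t]
  · have key := convexOn_smoothAbs.le_max_of_mem_Icc (mem_univ (-1)) (mem_univ 1) ⟨h'.le, h.le⟩
    rw [smoothAbs_neg_one, smoothAbs_one, max_self] at key
    linarith [abs_nonneg t]

/-! ### The regularised maximum -/

/-- The **regularised maximum** `m_η(x, y) = ½ (x + y + η S((x - y)/η))` of two real numbers
(`η > 0` the gluing width): a smooth convex symmetric function with `max(x,y) ≤ m_η(x,y) ≤
max(x,y) + η`, equal to `max(x, y)` as soon as `|x - y| ≥ η`. [folklore] -/
def smoothMax (η x y : ℝ) : ℝ := (x + y + η * smoothAbs ((x - y) / η)) / 2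

/-- `max(x, y) ≤ m_η(x, y)`. [folklore] -/
theorem max_le_smoothMax {η : ℝ} (hη : 0 < η) (x y : ℝ) : max x y ≤ smoothMax η x y := by
  unfold smoothMax
  have h1 : |x - y| ≤ η * smoothAbs ((x - y) / η) := by
    have := abs_le_smoothAbs ((x - y) / η)
    rw [abs_div, abs_of_pos hη, div_le_iff₀ hη] at this
    linarith
  have h2 : max x y = (x + y + |x - y|) / 2 := by
    rcases le_total x y with h | h
    · rw [max_eq_right h, abs_of_nonpos (by linarith)]; ring
    · rw [max_eq_left h, abs_of_nonneg (by linarith)]; ring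
  rw [h2]
  linarith

/-- `m_η(x, y) ≤ max(x, y) + η` (indeed `+ η/2`). [folklore] -/
theorem smoothMax_le_max_add {η : ℝ} (hη : 0 < η) (x y : ℝ) : smoothMax η x y ≤ max x y + η := by
  unfold smoothMax
  have h1 : η * smoothAbs ((x - y) / η) ≤ |x - y| + η := by
    have := smoothAbs_le_abs_add_one ((x - y) / η)
    rw [abs_div, abs_of_pos hη] at this
    have := mul_le_mul_of_nonneg_left this hη.le
    rw [mul_add, mul_div_cancel₀ _ hη.ne', mul_one] at this
    exact this
  have h2 : max x y = (x + y + |x - y|) / 2 := by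
    rcases le_total x y with h | h
    · rw [max_eq_right h, abs_of_nonpos (by linarith)]; ring
    · rw [max_eq_left h, abs_of_nonneg (by linarith)]; ring
  rw [h2]
  linarith

/-- `m_η(x, y) = x` when `x ≥ y + η`. [folklore] -/
theorem smoothMax_eq_left {η x y : ℝ} (hη : 0 < η) (h : y + η ≤ x) : smoothMax η x y = x := by
  unfold smoothMax
  rw [smoothAbs_of_one_le (by rw [le_div_iff₀ hη]; linarith), mul_div_cancel₀ _ hη.ne']
  ring

/-- `m_η(x, y) = y` when `y ≥ x + η`. [folklore] -/
theorem smoothMax_eq_right {η x y : ℝ} (hη : 0 < η) (h : x + η ≤ y) : smoothMax η x y = y := by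
  unfold smoothMax
  rw [smoothAbs_of_le_neg_one (by rw [div_le_iff₀ hη]; linarith), mul_neg,
    mul_div_cancel₀ _ hη.ne']
  ring

/-- `m_η(x + a, y + a) = m_η(x, y) + a`. [folklore] -/
theorem smoothMax_add_const (η x y a : ℝ) : smoothMax η (x + a) (y + a) = smoothMax η x y + a := by
  unfold smoothMax
  rw [show x + a - (y + a) = x - y by ring]
  ring

/-- `m_η` is `C^∞` on `ℝ²` (`η ≠ 0`). [folklore] -/
theorem contDiff_smoothMax {η : ℝ} {n : ℕ∞} :
    ContDiff ℝ n fun p : ℝ × ℝ ↦ smoothMax η p.1 p.2 := by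
  unfold smoothMax
  have h : ContDiff ℝ n fun p : ℝ × ℝ ↦ smoothAbs ((p.1 - p.2) / η) :=
    contDiff_smoothAbs.comp ((contDiff_fst.sub contDiff_snd).div_const η)
  exact ((contDiff_fst.add contDiff_snd).add (contDiff_const.mul h)).div_const 2

/-- `m_η` is non-decreasing in the first variable. [folklore] -/
theorem smoothMax_mono_left {η : ℝ} (hη : 0 < η) (y : ℝ) : Monotone fun x ↦ smoothMax η x y := by
  have hd : ∀ x, HasDerivAt (fun x ↦ smoothMax η x y)
      ((1 + η * (smoothSign ((x - y) / η) * (1 / η))) / 2) x := by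
    intro x
    unfold smoothMax
    have h1 : HasDerivAt (fun x ↦ (x - y) / η) (1 / η) x :=
      ((hasDerivAt_id x).sub_const y).div_const η
    have h2 : HasDerivAt (fun x ↦ smoothAbs ((x - y) / η))
        (smoothSign ((x - y) / η) * (1 / η)) x :=
      (hasDerivAt_smoothAbs _).comp x h1
    exact (((hasDerivAt_id x).add_const y).add (h2.const_mul η)).div_const 2
  refine monotone_of_deriv_nonneg (fun x ↦ (hd x).differentiableAt) fun x ↦ ?_
  rw [(hd x).deriv]
  have h : η * (smoothSign ((x - y) / η) * (1 / η)) = smoothSign ((x - y) / η) := by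
    field_simp
  rw [h]
  linarith [neg_one_le_smoothSign ((x - y) / η)]

/-- `m_η` is non-decreasing in the second variable. [folklore] -/
theorem smoothMax_mono_right {η : ℝ} (hη : 0 < η) (x : ℝ) : Monotone fun y ↦ smoothMax η x y := by
  have hd : ∀ y, HasDerivAt (fun y ↦ smoothMax η x y)
      ((1 + η * (smoothSign ((x - y) / η) * (-1 / η))) / 2) y := by
    intro y
    unfold smoothMax
    have h1 : HasDerivAt (fun y ↦ (x - y) / η) (-1 / η) y := by
      have := ((hasDerivAt_id y).const_sub x).div_const η
      simpa using this
    have h2 : HasDerivAt (fun y ↦ smoothAbs ((x - y) / η))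
        (smoothSign ((x - y) / η) * (-1 / η)) y :=
      (hasDerivAt_smoothAbs _).comp y h1
    exact (((hasDerivAt_id y).const_add x).add (h2.const_mul η)).div_const 2
  refine monotone_of_deriv_nonneg (fun y ↦ (hd y).differentiableAt) fun y ↦ ?_
  rw [(hd y).deriv]
  have h : η * (smoothSign ((x - y) / η) * (-1 / η)) = -smoothSign ((x - y) / η) := by
    field_simp
  rw [h]
  linarith [smoothSign_le_one ((x - y) / η)]

/-! ### The regularised maximum of two `C²` functions -/

section Comp

variable {E : Type*} [NormedAddCommGroup E] [NormedSpace ℝ E]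

/-- `σ` is differentiable with derivative `deriv σ`. [folklore] -/
theorem hasDerivAt_smoothSign (t : ℝ) : HasDerivAt smoothSign (deriv smoothSign t) t :=
  ((contDiff_smoothSign (n := 1)).differentiable one_ne_zero t).hasDerivAt

/-- The regularised maximum of two functions `C²` at `w` is `C²` at `w`. [folklore] -/
theorem ContDiffAt.smoothMax {a b : E → ℝ} {w : E} {η : ℝ} {n : ℕ∞} (ha : ContDiffAt ℝ n a w)
    (hb : ContDiffAt ℝ n b w) : ContDiffAt ℝ n (fun z ↦ smoothMax η (a z) (b z)) w :=
  (contDiff_smoothMax (η := η) (n := n)).contDiffAt.comp w (ha.prodMk hb)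

/-- **Second derivative of the regularised maximum of two `C²` functions** along the diagonal:
with `σ = smoothSign ((a w - b w)/η)` and `σ' = (smoothSign)' ((a w - b w)/η)`,
`D²(m_η(a,b))(w)(v,v) = ½(1+σ) D²a(w)(v,v) + ½(1-σ) D²b(w)(v,v) + σ'/(2η) (Da(w)v - Db(w)v)²`.
[folklore] -/
theorem fderiv_fderiv_smoothMax_apply {a b : E → ℝ} {w : E} {η : ℝ} (hη : η ≠ 0)
    (ha : ContDiffAt ℝ 2 a w) (hb : ContDiffAt ℝ 2 b w) (v : E) :
    fderiv ℝ (fderiv ℝ (fun z ↦ smoothMax η (a z) (b z))) w v v =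
      (1 + smoothSign ((a w - b w) / η)) / 2 * fderiv ℝ (fderiv ℝ a) w v v
      + (1 - smoothSign ((a w - b w) / η)) / 2 * fderiv ℝ (fderiv ℝ b) w v v
      + deriv smoothSign ((a w - b w) / η) / (2 * η) * (fderiv ℝ a w v - fderiv ℝ b w v) ^ 2 := by
  -- first-order data near `w`, second-order data at `w`
  have h1a : ∀ᶠ z in 𝓝 w, HasFDerivAt a (fderiv ℝ a z) z := by
    filter_upwards [ha.eventually (by simp)] with z hz
    exact (hz.differentiableAt (by simp)).hasFDerivAt
  have h1b : ∀ᶠ z in 𝓝 w, HasFDerivAt b (fderiv ℝ b z) z := by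
    filter_upwards [hb.eventually (by simp)] with z hz
    exact (hz.differentiableAt (by simp)).hasFDerivAt
  have h2a : HasFDerivAt (fderiv ℝ a) (fderiv ℝ (fderiv ℝ a) w) w :=
    ((ha.fderiv_right (m := 1) le_rfl).differentiableAt one_ne_zero).hasFDerivAt
  have h2b : HasFDerivAt (fderiv ℝ b) (fderiv ℝ (fderiv ℝ b) w) w :=
    ((hb.fderiv_right (m := 1) le_rfl).differentiableAt one_ne_zero).hasFDerivAt
  -- rewrite the function
  have hfun : (fun z ↦ smoothMax η (a z) (b z)) =
      fun z ↦ 2⁻¹ * (a z + b z) + (2⁻¹ * η) * smoothAbs (η⁻¹ * (a z - b z)) := by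
    funext z
    simp only [smoothMax, div_eq_inv_mul]
    ring
  rw [hfun]
  -- the first derivative near `w`
  set F : E → E →L[ℝ] ℝ := fun z ↦ (2⁻¹ : ℝ) • (fderiv ℝ a z + fderiv ℝ b z)
    + (2⁻¹ * η) • (smoothSign (η⁻¹ * (a z - b z)) • ((η⁻¹ : ℝ) • (fderiv ℝ a z - fderiv ℝ b z)))
    with hF
  have hderiv : ∀ᶠ z in 𝓝 w, HasFDerivAt
      (fun z ↦ 2⁻¹ * (a z + b z) + (2⁻¹ * η) * smoothAbs (η⁻¹ * (a z - b z))) (F z) z := by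
    filter_upwards [h1a, h1b] with z hza hzb
    have hd : HasFDerivAt (fun z ↦ η⁻¹ * (a z - b z)) ((η⁻¹ : ℝ) • (fderiv ℝ a z - fderiv ℝ b z)) z :=
      (hza.sub hzb).const_mul η⁻¹
    have hS := ((hasDerivAt_smoothAbs _).comp_hasFDerivAt z hd).const_mul (2⁻¹ * η)
    have hsum := ((hza.add hzb).const_mul 2⁻¹).add hS
    exact hsum
  have hfderiv : fderiv ℝ (fun z ↦ 2⁻¹ * (a z + b z) + (2⁻¹ * η) * smoothAbs (η⁻¹ * (a z - b z)))
      =ᶠ[𝓝 w] F := by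
    filter_upwards [hderiv] with z hz using hz.fderiv
  rw [hfderiv.fderiv_eq]
  -- the second derivative at `w`
  have hd0 : HasFDerivAt (fun z ↦ η⁻¹ * (a z - b z))
      ((η⁻¹ : ℝ) • (fderiv ℝ a w - fderiv ℝ b w)) w :=
    (h1a.self_of_nhds.sub h1b.self_of_nhds).const_mul η⁻¹
  have hc : HasFDerivAt (fun z ↦ smoothSign (η⁻¹ * (a z - b z)))
      (deriv smoothSign (η⁻¹ * (a w - b w)) • ((η⁻¹ : ℝ) • (fderiv ℝ a w - fderiv ℝ b w))) w :=
    (hasDerivAt_smoothSign _).comp_hasFDerivAt w hd0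
  have hf : HasFDerivAt (fun z ↦ (η⁻¹ : ℝ) • (fderiv ℝ a z - fderiv ℝ b z))
      ((η⁻¹ : ℝ) • (fderiv ℝ (fderiv ℝ a) w - fderiv ℝ (fderiv ℝ b) w)) w :=
    (h2a.sub h2b).const_smul η⁻¹
  have hF' : HasFDerivAt F
      ((2⁻¹ : ℝ) • (fderiv ℝ (fderiv ℝ a) w + fderiv ℝ (fderiv ℝ b) w)
        + (2⁻¹ * η) • (smoothSign (η⁻¹ * (a w - b w)) •
            ((η⁻¹ : ℝ) • (fderiv ℝ (fderiv ℝ a) w - fderiv ℝ (fderiv ℝ b) w))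
          + (deriv smoothSign (η⁻¹ * (a w - b w)) •
              ((η⁻¹ : ℝ) • (fderiv ℝ a w - fderiv ℝ b w))).smulRight
            ((η⁻¹ : ℝ) • (fderiv ℝ a w - fderiv ℝ b w)))) w := by
    rw [hF]
    exact ((h2a.add h2b).const_smul (2⁻¹ : ℝ)).add ((hc.smul hf).const_smul (2⁻¹ * η))
  rw [hF'.fderiv]
  simp only [add_apply, smul_apply, sub_apply, ContinuousLinearMap.smulRight_apply, smul_eq_mul,
    div_eq_inv_mul]
  field_simp
  ring

open Complex in
/-- **The regularised maximum of two `C²` plurisubharmonic functions is plurisubharmonic** (smooth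
case, pointwise): if `a, b : ℂⁿ → ℝ` are `C²` at `w` with non-negative Levi forms
`D²a(w)(v,v) + D²a(w)(iv,iv) ≥ 0`, `D²b(w)(v,v) + D²b(w)(iv,iv) ≥ 0`, then so is `m_η(a, b)`:
its Levi form is `½(1+σ)·Levi(a) + ½(1-σ)·Levi(b) + σ'/(2η)(|∂(a-b)·v|²-terms) ≥ 0`.
[folklore] -/
theorem levi_smoothMax_nonneg {n : ℕ} {a b : (Fin n → ℂ) → ℝ} {w : Fin n → ℂ} {η : ℝ}
    (hη : 0 < η) (ha : ContDiffAt ℝ 2 a w) (hb : ContDiffAt ℝ 2 b w)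
    (hLa : ∀ v, 0 ≤ fderiv ℝ (fderiv ℝ a) w v v + fderiv ℝ (fderiv ℝ a) w (I • v) (I • v))
    (hLb : ∀ v, 0 ≤ fderiv ℝ (fderiv ℝ b) w v v + fderiv ℝ (fderiv ℝ b) w (I • v) (I • v))
    (v : Fin n → ℂ) :
    0 ≤ fderiv ℝ (fderiv ℝ (fun z ↦ smoothMax η (a z) (b z))) w v v
      + fderiv ℝ (fderiv ℝ (fun z ↦ smoothMax η (a z) (b z))) w (I • v) (I • v) := by
  rw [fderiv_fderiv_smoothMax_apply hη.ne' ha hb v, fderiv_fderiv_smoothMax_apply hη.ne' ha hb (I • v)]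
  set σ := smoothSign ((a w - b w) / η)
  set σ' := deriv smoothSign ((a w - b w) / η)
  have hσ1 : 0 ≤ (1 + σ) / 2 := by linarith [neg_one_le_smoothSign ((a w - b w) / η)]
  have hσ2 : 0 ≤ (1 - σ) / 2 := by linarith [smoothSign_le_one ((a w - b w) / η)]
  have hσ' : 0 ≤ σ' / (2 * η) := div_nonneg (deriv_smoothSign_nonneg _) (by linarith)
  have key : (1 + σ) / 2 * fderiv ℝ (fderiv ℝ a) w v v
      + (1 - σ) / 2 * fderiv ℝ (fderiv ℝ b) w v v
      + σ' / (2 * η) * (fderiv ℝ a w v - fderiv ℝ b w v) ^ 2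
      + ((1 + σ) / 2 * fderiv ℝ (fderiv ℝ a) w (I • v) (I • v)
      + (1 - σ) / 2 * fderiv ℝ (fderiv ℝ b) w (I • v) (I • v)
      + σ' / (2 * η) * (fderiv ℝ a w (I • v) - fderiv ℝ b w (I • v)) ^ 2)
      = (1 + σ) / 2 * (fderiv ℝ (fderiv ℝ a) w v v + fderiv ℝ (fderiv ℝ a) w (I • v) (I • v))
      + (1 - σ) / 2 * (fderiv ℝ (fderiv ℝ b) w v v + fderiv ℝ (fderiv ℝ b) w (I • v) (I • v))
      + σ' / (2 * η) * ((fderiv ℝ a w v - fderiv ℝ b w v) ^ 2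
        + (fderiv ℝ a w (I • v) - fderiv ℝ b w (I • v)) ^ 2) := by ring
  rw [key]
  have := hLa v
  have := hLb v
  positivity

end Comp

end Literature.Analysis.Pluripotential

end
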